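import Literature.MathematicalPhysics.QuantumLattice.FinDimSpectrum
import HarnessLib

/-!
# Discharges and API for the tracial ground-state functional (`FinDimSpectrum`)

Trunk T-QLATTICE. Sibling proof file of
`Literature/MathematicalPhysics/QuantumLattice/FinDimSpectrum.lean`: it discharges named facts
(`def X : Prop`, D-0014) of that file as `theorem X_holds : X` and proves the elementary "state"
properties of the tracial ground-state functional `Matrix.groundStateFunctional A`,
`O ↦ tr (P₀ O) / tr P₀` (`P₀ = Matrix.groundProj A`), which every ground-state statement of the
`hubbard` family consumes (first customer: the Kennedy–Lieb–Shastry decomposition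
`XYOrderProofs.lean`, facts (B), (D), (S), (T)). No statement is introduced or changed here.

Discharged:

* `Matrix.groundSpace_ne_bot_holds : groundSpace_ne_bot` — a Hermitian matrix on a nonempty
  index type has a ground-state vector (an eigenvector for the least eigenvalue).
* `Matrix.groundEnergy_le_rayleigh_holds : groundEnergy_le_rayleigh` — the variational
  principle `E₀ ≤ re ⟨ψ, A ψ⟩` for unit `ψ` (`A - E₀ ≥ 0` in the C⋆-order of matrices).
* `Matrix.rayleigh_eq_groundEnergy_iff_holds : rayleigh_eq_groundEnergy_iff` and
  `Matrix.minEnergyOn_top_holds : minEnergyOn_top` (equality case of the variational principle;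
  the sector energy on the whole space is `E₀`).
* `Matrix.hasSpectralGap_iff_hasClusterGap_one_holds : hasSpectralGap_iff_hasClusterGap_one` —
  the "unique gapped ground state" predicate `Matrix.HasSpectralGap A Δ` (transported from
  `ContinuousLinearMap.HasSpectralGap` along `Matrix.toEuclideanCLM`) coincides with the cluster
  gap `Matrix.HasClusterGap A 1 0 Δ` (one eigenvalue in the window `[E₀, E₀]`, all others
  `≥ E₀ + Δ`); helpers `isSelfAdjoint_toEuclideanCLM_iff`,
  `IsHermitian.re_image_spectrum_toEuclideanCLM`, `IsHermitian.filter_eigenvalues_le_iInf`.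

API (all `A` Hermitian where needed):

* `groundProj_mulVec_of_mem`, `groundProj_mulVec_mem` — `P₀ v = v` on the ground space and
  `P₀ w ∈` ground space; `mul_groundProj : A * P₀ = E₀ • P₀`, `groundProj_mul : P₀ * A = E₀ • P₀`;
* `groundProj_ne_zero`, `trace_groundProj_pos` (`0 < tr P₀`, in `ℂ` with the complex order);
* `groundStateFunctional_one` (`ω 1 = 1`), `groundStateFunctional_conjTranspose`
  (`ω Oᴴ = star (ω O)`), `groundStateFunctional_hamiltonian_mul/mul_hamiltonian`
  (`ω (A O) = E₀ ω O = ω (O A)`), `groundStateFunctional_hamiltonian` (`ω A = E₀`),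
  `groundStateFunctional_nonneg` (`0 ≤ ω (Oᴴ O)`), `groundStateFunctional_re_le_of_le`
  (variational comparison `re ω B ≥ E₀(B)` for Hermitian `B`);
* `groundProj_commute_of_commute` (`U` unitary, `U A = A U ⇒ P₀ U = U P₀`) and
  `groundStateFunctional_conj_unitary` (`ω (U O Uᴴ) = ω O`): the tracial ground state is
  invariant under every symmetry of the Hamiltonian.

## Sources

H. Tasaki, *Physics and Mathematics of Quantum Many-Body Systems* (2020), §2.1 (ground states,
variational characterisation (2.1.6)), App. A.2 (projections); O. Bratteli, D. W. Robinson,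
*Operator Algebras and Quantum Statistical Mechanics II*, §5.3.1 (ground states as `β → ∞`
limits of Gibbs states; states are positive normalised functionals); Reed–Simon IV, Thm. XIII.1
(min–max). For the notion "unique gapped ground state" of a finite system (a unique ground
state accompanied by a nonzero energy gap not less than `Δ`) see also H. Tasaki, *The
Lieb–Schultz–Mattis theorem: a topological point of view*, arXiv:2202.06243 (2022), §2.2 (PDF
p. 6) and Definition 2.5 (p. 5: "the two definitions coincide in a finite system"). All statements
here are finite-dimensional linear algebra. [folklore]

## Proof notes

`groundProj A = projMatrix (map e⁻¹ (groundSpace A))` with `e = WithLp.linearEquiv 2 ℂ (n → ℂ)`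
and `projMatrix K *ᵥ x = K.starProjection x` (`projMatrix_mulVec`), so `P₀` fixes the ground
space and maps into it (Mathlib `Submodule.starProjection_eq_self_iff`,
`Submodule.starProjection_apply_mem`); `A * P₀ = E₀ • P₀` follows column-wise
(`Matrix.ext_iff_mulVec`) and `P₀ * A = E₀ • P₀` by taking adjoints. For a unitary `U` commuting
with `A` both `U` and `Uᴴ` preserve the ground space, whence `P₀ U P₀ = U P₀` and
`P₀ Uᴴ P₀ = Uᴴ P₀`; the adjoint of the second is `P₀ U P₀ = P₀ U`. The variational principle:
`spectrum ℝ A = range eigenvalues ⊆ [E₀, ∞)` (`groundEnergy_le_eigenvalues`), so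
`algebraMap E₀ ≤ A` in the continuous-functional-calculus order (`algebraMap_le_iff_le_spectrum`),
i.e. `A - E₀ • 1` is positive semidefinite (`Matrix.nonneg_iff_posSemidef`).

`hasSpectralGap_iff_hasClusterGap_one`: with `T = toEuclideanCLM A`, `IsSelfAdjoint T ↔
A.IsHermitian` (star-equivalence), `T.groundEnergy = A.groundEnergy = ⨅ i, λᵢ`
(`groundEnergy_eq_iInf_eigenvalues_holds`), `re '' σ(T) = range λ` (`spectrum_toEuclideanCLM`,
`Matrix.IsHermitian.spectrum_eq_image_range`), and the simple-ground-eigenvalue conjunct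
`finrank (eigenspace T E₀) = 1` is `#{i | λᵢ ≤ E₀} = #{i | λᵢ = E₀} = 1`
(`HasSpectralGap.hasUniqueGroundState`, `HasClusterGap.groundStateDegeneracy_eq`,
`IsHermitian.card_filter_eigenvalues_eq`, `finrank_eigenspace_toEuclideanLin`). No case split on
an empty index type is needed (both predicates are then false).
-/

noncomputable section

open scoped Matrix.Norms.L2Operator ComplexOrder MatrixOrder InnerProductSpace

namespace Matrix

open Literature.MathematicalPhysics.QuantumLattice

variable {n : Type*} [Fintype n] [DecidableEq n]

/-! ### The ground-state projection fixes the ground space and maps into it -/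

/-- The Euclidean copy of the ground space used in the definition of `groundProj`. [folklore] -/
theorem groundProj_eq (A : Matrix n n ℂ) :
    A.groundProj = projMatrix (A.groundSpace.map
      ((WithLp.linearEquiv 2 ℂ (n → ℂ)).symm : (n → ℂ) →ₗ[ℂ] EuclideanSpace ℂ n)) := rfl

/-- `P₀ v = v` for `v` in the ground space. Tasaki (2020) App. A.2. [folklore] -/
theorem groundProj_mulVec_of_mem (A : Matrix n n ℂ) {v : n → ℂ} (hv : v ∈ A.groundSpace) :
    A.groundProj *ᵥ v = v := by
  set K := A.groundSpace.map
    ((WithLp.linearEquiv 2 ℂ (n → ℂ)).symm : (n → ℂ) →ₗ[ℂ] EuclideanSpace ℂ n) with hK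
  have hmem : (WithLp.toLp 2 v : EuclideanSpace ℂ n) ∈ K :=
    Submodule.mem_map_of_mem (f := ((WithLp.linearEquiv 2 ℂ (n → ℂ)).symm :
      (n → ℂ) →ₗ[ℂ] EuclideanSpace ℂ n)) hv
  have h := projMatrix_mulVec K (WithLp.toLp 2 v)
  rw [Submodule.starProjection_eq_self_iff.mpr hmem] at h
  simpa [groundProj_eq] using h

/-- `P₀ w` lies in the ground space for every `w`. Tasaki (2020) App. A.2. [folklore] -/
theorem groundProj_mulVec_mem (A : Matrix n n ℂ) (w : n → ℂ) :
    A.groundProj *ᵥ w ∈ A.groundSpace := by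
  set K := A.groundSpace.map
    ((WithLp.linearEquiv 2 ℂ (n → ℂ)).symm : (n → ℂ) →ₗ[ℂ] EuclideanSpace ℂ n) with hK
  have h := projMatrix_mulVec K (WithLp.toLp 2 w)
  have hmem : K.starProjection (WithLp.toLp 2 w) ∈ K := Submodule.starProjection_apply_mem K _
  obtain ⟨u, hu, hu'⟩ := Submodule.mem_map.1 hmem
  have : A.groundProj *ᵥ w = u := by
    rw [groundProj_eq, ← hK]
    change projMatrix K *ᵥ (WithLp.ofLp (WithLp.toLp 2 w)) = u
    rw [h, ← hu']
    rfl
  rw [this]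
  exact hu

/-- `A P₀ = E₀ P₀`: the columns of `P₀` are ground-state vectors. Tasaki (2020) §2.1. [folklore] -/
theorem mul_groundProj (A : Matrix n n ℂ) :
    A * A.groundProj = (A.groundEnergy : ℂ) • A.groundProj := by
  rw [ext_iff_mulVec]
  intro v
  rw [← mulVec_mulVec, smul_mulVec]
  exact (mem_groundSpace_iff A _).1 (groundProj_mulVec_mem A v)

/-- `P₀` is Hermitian. [folklore] -/
theorem groundProj_isHermitian (A : Matrix n n ℂ) : A.groundProj.IsHermitian :=
  projMatrix_isHermitian _

/-- `P₀² = P₀`. [folklore] -/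
theorem groundProj_mul_self (A : Matrix n n ℂ) : A.groundProj * A.groundProj = A.groundProj :=
  projMatrix_mul_self _

/-- `P₀ A = E₀ P₀` for Hermitian `A` (adjoint of `mul_groundProj`). Tasaki (2020) §2.1.
[folklore] -/
theorem groundProj_mul {A : Matrix n n ℂ} (hA : A.IsHermitian) :
    A.groundProj * A = (A.groundEnergy : ℂ) • A.groundProj := by
  have h := congrArg conjTranspose (mul_groundProj A)
  rw [conjTranspose_mul, conjTranspose_smul, (groundProj_isHermitian A).eq, hA.eq] at h
  rw [h]
  simp

/-! ### Existence of ground states; `tr P₀ > 0` -/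

/-- Discharge of `groundSpace_ne_bot`: the least eigenvalue `E₀ = ⨅ᵢ λᵢ` is attained at some
index `i₀` (finite index type) and the `i₀`-th vector of the eigenvector basis is a nonzero
ground-state vector. Tasaki (2020) §2.1. [folklore] -/
theorem groundSpace_ne_bot_holds : groundSpace_ne_bot (n := n) := by
  intro A hA _
  obtain ⟨i₀, hi₀⟩ := exists_eq_ciInf_of_finite (f := hA.eigenvalues)
  have hE : A.groundEnergy = hA.eigenvalues i₀ := by
    rw [groundEnergy_eq_iInf_eigenvalues_holds hA, hi₀]
  set v : n → ℂ := ⇑(hA.eigenvectorBasis i₀) with hv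
  have hvmem : v ∈ A.groundSpace := by
    rw [mem_groundSpace_iff, hE, hv, hA.mulVec_eigenvectorBasis i₀,
      RCLike.real_smul_eq_coe_smul (K := ℂ)]
    rfl
  have hv0 : v ≠ 0 := by
    intro h
    have h1 : ‖hA.eigenvectorBasis i₀‖ = 1 := (hA.eigenvectorBasis).orthonormal.1 i₀
    have h2 : hA.eigenvectorBasis i₀ = 0 := by
      apply WithLp.ofLp_injective 2
      simpa [hv] using h
    rw [h2, norm_zero] at h1
    exact zero_ne_one h1
  intro hbot
  rw [hbot, Submodule.mem_bot] at hvmem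
  exact hv0 hvmem

/-- `P₀ ≠ 0` for Hermitian `A` on a nonempty index type. [folklore] -/
theorem groundProj_ne_zero {A : Matrix n n ℂ} (hA : A.IsHermitian) [Nonempty n] :
    A.groundProj ≠ 0 := by
  intro h0
  apply groundSpace_ne_bot_holds hA
  rw [Submodule.eq_bot_iff]
  intro v hv
  rw [← groundProj_mulVec_of_mem A hv, h0, zero_mulVec]

/-- `P₀` is positive semidefinite (`P₀ = P₀ᴴ P₀`). [folklore] -/
theorem posSemidef_groundProj (A : Matrix n n ℂ) : A.groundProj.PosSemidef := by
  have h : A.groundProj = A.groundProjᴴ * A.groundProj := by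
    rw [(groundProj_isHermitian A).eq, groundProj_mul_self]
  rw [h]
  exact posSemidef_conjTranspose_mul_self _

/-- `0 < tr P₀` (in `ℂ` with the complex order) for Hermitian `A` on a nonempty index type: the
trace of a nonzero positive semidefinite matrix is positive
(`Matrix.PosSemidef.trace_eq_zero_iff`). [folklore] -/
theorem trace_groundProj_pos {A : Matrix n n ℂ} (hA : A.IsHermitian) [Nonempty n] :
    0 < A.groundProj.trace := by
  have hP := posSemidef_groundProj A
  refine lt_of_le_of_ne hP.trace_nonneg fun h => groundProj_ne_zero hA ?_
  exact hP.trace_eq_zero_iff.1 h.symm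

/-- `tr P₀ ≠ 0`. [folklore] -/
theorem trace_groundProj_ne_zero {A : Matrix n n ℂ} (hA : A.IsHermitian) [Nonempty n] :
    A.groundProj.trace ≠ 0 :=
  (trace_groundProj_pos hA).ne'

/-! ### The tracial ground-state functional is a normalised positive Hermitian functional -/

/-- `ω(1) = 1`. Bratteli–Robinson II §5.3.1. [folklore] -/
theorem groundStateFunctional_one {A : Matrix n n ℂ} (hA : A.IsHermitian) [Nonempty n] :
    A.groundStateFunctional 1 = 1 := by
  rw [groundStateFunctional_apply, mul_one, inv_mul_cancel₀ (trace_groundProj_ne_zero hA)]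

/-- `ω(Oᴴ) = conj ω(O)` (`P₀` is Hermitian, `tr Xᴴ = conj tr X`, cyclicity). [folklore] -/
theorem groundStateFunctional_conjTranspose (A O : Matrix n n ℂ) :
    A.groundStateFunctional Oᴴ = star (A.groundStateFunctional O) := by
  have hP : A.groundProjᴴ = A.groundProj := (groundProj_isHermitian A).eq
  rw [groundStateFunctional_apply, groundStateFunctional_apply, star_mul', star_inv₀,
    ← trace_conjTranspose, ← trace_conjTranspose, conjTranspose_mul, hP, trace_mul_comm]

/-- The real part of `ω` is symmetric under `O ↦ Oᴴ`: `re ω(Oᴴ) = re ω(O)`. [folklore] -/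
theorem groundStateFunctional_conjTranspose_re (A O : Matrix n n ℂ) :
    (A.groundStateFunctional Oᴴ).re = (A.groundStateFunctional O).re := by
  rw [groundStateFunctional_conjTranspose]
  simp

/-- `ω(A O) = E₀ ω(O)` for Hermitian `A` (`P₀ A = E₀ P₀`). Tasaki (2020) §2.1. [folklore] -/
theorem groundStateFunctional_hamiltonian_mul {A : Matrix n n ℂ} (hA : A.IsHermitian)
    (O : Matrix n n ℂ) :
    A.groundStateFunctional (A * O) = A.groundEnergy * A.groundStateFunctional O := by
  rw [groundStateFunctional_apply, groundStateFunctional_apply, ← mul_assoc, groundProj_mul hA,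
    smul_mul_assoc, trace_smul, smul_eq_mul]
  ring

/-- `ω(O A) = E₀ ω(O)` (`A P₀ = E₀ P₀` and cyclicity; no hermiticity needed). Tasaki (2020) §2.1.
[folklore] -/
theorem groundStateFunctional_mul_hamiltonian (A O : Matrix n n ℂ) :
    A.groundStateFunctional (O * A) = A.groundEnergy * A.groundStateFunctional O := by
  rw [groundStateFunctional_apply, groundStateFunctional_apply, ← mul_assoc, trace_mul_comm,
    ← mul_assoc, mul_groundProj, smul_mul_assoc, trace_smul, smul_eq_mul]
  ring

/-- `ω(A) = E₀`: the tracial ground state has the ground energy. Tasaki (2020) §2.1. [folklore] -/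
theorem groundStateFunctional_hamiltonian {A : Matrix n n ℂ} (hA : A.IsHermitian) [Nonempty n] :
    A.groundStateFunctional A = A.groundEnergy := by
  have h := groundStateFunctional_hamiltonian_mul hA 1
  rwa [mul_one, groundStateFunctional_one hA, mul_one] at h

/-- Positivity: `0 ≤ ω(Oᴴ O)` (`tr (P₀ Oᴴ O) = tr (O P₀ Oᴴ) ≥ 0` and `tr P₀ ≥ 0`).
Bratteli–Robinson II §5.3.1. [folklore] -/
theorem groundStateFunctional_nonneg (A O : Matrix n n ℂ) :
    0 ≤ A.groundStateFunctional (Oᴴ * O) := by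
  have hW := posSemidef_groundProj A
  rw [groundStateFunctional_apply]
  refine mul_nonneg ?_ ?_
  · have hZ : 0 ≤ A.groundProj.trace := hW.trace_nonneg
    obtain ⟨hre, him⟩ := Complex.nonneg_iff.mp hZ
    rw [Complex.nonneg_iff]
    simp [Complex.inv_re, Complex.inv_im, ← him, div_nonneg, hre, Complex.normSq_nonneg]
  · rw [← mul_assoc, trace_mul_cycle]
    exact (hW.mul_mul_conjTranspose_same O).trace_nonneg

/-- Positivity on positive semidefinite observables: `0 ≤ ω(O)` for `O ≥ 0`. [folklore] -/
theorem groundStateFunctional_nonneg_of_posSemidef (A : Matrix n n ℂ) {O : Matrix n n ℂ}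
    (hO : O.PosSemidef) : 0 ≤ A.groundStateFunctional O := by
  obtain ⟨B, hB⟩ := CStarAlgebra.nonneg_iff_eq_star_mul_self.mp hO.nonneg
  rw [hB]
  exact groundStateFunctional_nonneg A B

/-! ### Symmetries: the tracial ground state is invariant under unitaries commuting with `A` -/

/-- An operator commuting with `A` preserves the ground space. [folklore] -/
theorem mulVec_mem_groundSpace_of_commute {A U : Matrix n n ℂ} (hU : U * A = A * U) {v : n → ℂ}
    (hv : v ∈ A.groundSpace) : U *ᵥ v ∈ A.groundSpace := by
  rw [mem_groundSpace_iff] at hv ⊢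
  rw [mulVec_mulVec, ← hU, ← mulVec_mulVec, hv, mulVec_smul]

/-- `P₀ U P₀ = U P₀` for `U` commuting with `A`. [folklore] -/
theorem groundProj_mul_mul_groundProj_of_commute {A U : Matrix n n ℂ} (hU : U * A = A * U) :
    A.groundProj * U * A.groundProj = U * A.groundProj := by
  rw [ext_iff_mulVec]
  intro v
  rw [← mulVec_mulVec, ← mulVec_mulVec, ← mulVec_mulVec]
  exact groundProj_mulVec_of_mem A
    (mulVec_mem_groundSpace_of_commute hU (groundProj_mulVec_mem A v))

omit [DecidableEq n] in
/-- `Uᴴ` commutes with a Hermitian `A` if `U` does. [folklore] -/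
theorem conjTranspose_commute_of_commute {A U : Matrix n n ℂ} (hA : A.IsHermitian)
    (hU : U * A = A * U) : Uᴴ * A = A * Uᴴ := by
  have h := congrArg conjTranspose hU
  rw [conjTranspose_mul, conjTranspose_mul, hA.eq] at h
  exact h.symm

/-- **The ground-state projection commutes with every operator commuting with `A`** (`A`
Hermitian): from `P₀ U P₀ = U P₀` and the adjoint of `P₀ Uᴴ P₀ = Uᴴ P₀`. Tasaki (2020) §2.1
(symmetry of the ground-state expectation). [folklore] -/
theorem groundProj_commute_of_commute {A U : Matrix n n ℂ} (hA : A.IsHermitian)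
    (hU : U * A = A * U) : A.groundProj * U = U * A.groundProj := by
  have h1 := groundProj_mul_mul_groundProj_of_commute hU
  have h2 := groundProj_mul_mul_groundProj_of_commute (conjTranspose_commute_of_commute hA hU)
  have h3 := congrArg conjTranspose h2
  rw [conjTranspose_mul, conjTranspose_mul, conjTranspose_mul, conjTranspose_conjTranspose,
    (groundProj_isHermitian A).eq, ← mul_assoc] at h3
  exact h3.symm.trans h1

/-- **Invariance of the tracial ground state under symmetries**: for `U` with `Uᴴ U = 1`
commuting with the Hermitian `A`, `ω(U O Uᴴ) = ω(O)`. Tasaki (2020) §2.1. [folklore] -/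
theorem groundStateFunctional_conj_of_commute {A U : Matrix n n ℂ} (hA : A.IsHermitian)
    (hU : U * A = A * U) (hUU : Uᴴ * U = 1) (O : Matrix n n ℂ) :
    A.groundStateFunctional (U * O * Uᴴ) = A.groundStateFunctional O := by
  rw [groundStateFunctional_apply, groundStateFunctional_apply]
  congr 1
  calc (A.groundProj * (U * O * Uᴴ)).trace = (Uᴴ * (A.groundProj * U * O)).trace := by
        rw [trace_mul_comm Uᴴ, ← mul_assoc, ← mul_assoc]
    _ = (A.groundProj * O).trace := by
        rw [groundProj_commute_of_commute hA hU, ← mul_assoc, ← mul_assoc, hUU, one_mul]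

/-- The same invariance in the form `ω(Uᴴ O U) = ω(O)` for `U Uᴴ = 1`. [folklore] -/
theorem groundStateFunctional_conj_of_commute' {A U : Matrix n n ℂ} (hA : A.IsHermitian)
    (hU : U * A = A * U) (hUU : U * Uᴴ = 1) (O : Matrix n n ℂ) :
    A.groundStateFunctional (Uᴴ * O * U) = A.groundStateFunctional O := by
  have h := groundStateFunctional_conj_of_commute hA (conjTranspose_commute_of_commute hA hU)
    (by simpa using hUU) O
  simpa using h

/-! ### The variational principle -/

/-- `A - E₀ ≥ 0` for Hermitian `A`: the real spectrum is the range of the eigenvalues, all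
`≥ E₀` (`groundEnergy_le_eigenvalues`), and `algebraMap E₀ ≤ A` iff `E₀ ≤ σ(A)`
(`algebraMap_le_iff_le_spectrum`). Reed–Simon IV, Thm. XIII.1. [folklore] -/
theorem posSemidef_sub_groundEnergy {A : Matrix n n ℂ} (hA : A.IsHermitian) :
    (A - algebraMap ℝ (Matrix n n ℂ) A.groundEnergy).PosSemidef := by
  have hle : algebraMap ℝ (Matrix n n ℂ) A.groundEnergy ≤ A := by
    rw [algebraMap_le_iff_le_spectrum (ha := hA.isSelfAdjoint)]
    intro x hx
    rw [hA.spectrum_real_eq_range_eigenvalues] at hx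
    obtain ⟨i, rfl⟩ := hx
    exact groundEnergy_le_eigenvalues hA i
  exact Matrix.le_iff.1 hle

/-- Discharge of `groundEnergy_le_rayleigh`: `E₀ ≤ re ⟨ψ, A ψ⟩` for unit `ψ`
(`⟨ψ, (A - E₀) ψ⟩ ≥ 0`). Tasaki (2020) §2.1, (2.1.6); Reed–Simon IV, Thm. XIII.1. [folklore] -/
theorem groundEnergy_le_rayleigh_holds : groundEnergy_le_rayleigh (n := n) := by
  intro A hA ψ hψ
  have h := (posSemidef_sub_groundEnergy hA).dotProduct_mulVec_nonneg ψ
  rw [sub_mulVec, dotProduct_sub, Algebra.algebraMap_eq_smul_one, smul_mulVec, one_mulVec,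
    dotProduct_smul, hψ] at h
  obtain ⟨hre, -⟩ := Complex.nonneg_iff.mp h
  simp only [Complex.sub_re, Complex.real_smul, mul_one, Complex.ofReal_re] at hre
  linarith

/-- Variational comparison for the tracial ground state: for Hermitian `B` on a nonempty index
type, `E₀(B) ≤ re ω_A(B)` — the ground state of `A` is a trial state for `B`
(`ω_A(B - E₀(B)) ≥ 0` by positivity of `ω_A`). This is the form in which "the energy could be
lowered" arguments (Kubo, Kennedy–Lieb–Shastry) are used. Tasaki (2020) §2.1. [folklore] -/
theorem groundEnergy_le_groundStateFunctional_re {A B : Matrix n n ℂ} (hA : A.IsHermitian)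
    (hB : B.IsHermitian) [Nonempty n] :
    B.groundEnergy ≤ (A.groundStateFunctional B).re := by
  have h := groundStateFunctional_nonneg_of_posSemidef A (posSemidef_sub_groundEnergy hB)
  rw [map_sub, Algebra.algebraMap_eq_smul_one, LinearMap.map_smul_of_tower,
    groundStateFunctional_one hA] at h
  obtain ⟨hre, -⟩ := Complex.nonneg_iff.mp h
  simp only [Complex.sub_re, Complex.real_smul, mul_one, Complex.ofReal_re] at hre
  linarith

/-- Discharge of `rayleigh_eq_groundEnergy_iff`: for a unit vector, `re ⟨ψ, A ψ⟩ = E₀` iff `ψ` is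
in the ground space. (`⇐`: `A ψ = E₀ ψ`. `⇒`: `⟨ψ, (A - E₀) ψ⟩ = 0` for the positive
semidefinite `A - E₀`, hence `(A - E₀) ψ = 0`, Mathlib
`Matrix.PosSemidef.dotProduct_mulVec_zero_iff`.)
Tasaki (2020) §2.1. [folklore] -/
theorem rayleigh_eq_groundEnergy_iff_holds : rayleigh_eq_groundEnergy_iff (n := n) := by
  intro A hA ψ hψ
  have hM := posSemidef_sub_groundEnergy hA
  have hform : star ψ ⬝ᵥ (A - algebraMap ℝ (Matrix n n ℂ) A.groundEnergy) *ᵥ ψ =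
      star ψ ⬝ᵥ A *ᵥ ψ - (A.groundEnergy : ℂ) := by
    rw [sub_mulVec, dotProduct_sub, Algebra.algebraMap_eq_smul_one, smul_mulVec, one_mulVec,
      dotProduct_smul, hψ, Complex.real_smul, mul_one]
  constructor
  · intro hre
    have h0 := hM.dotProduct_mulVec_nonneg ψ
    rw [hform] at h0
    obtain ⟨-, him⟩ := Complex.nonneg_iff.mp h0
    have hzero : star ψ ⬝ᵥ (A - algebraMap ℝ (Matrix n n ℂ) A.groundEnergy) *ᵥ ψ = 0 := by
      rw [hform]
      apply Complex.ext
      · simp [hre]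
      · simpa using him.symm
    have hker := (hM.dotProduct_mulVec_zero_iff ψ).1 hzero
    rw [sub_mulVec, Algebra.algebraMap_eq_smul_one, smul_mulVec, one_mulVec, sub_eq_zero] at hker
    rw [mem_groundSpace_iff, hker, Complex.coe_smul]
  · intro hmem
    rw [(mem_groundSpace_iff A ψ).1 hmem, dotProduct_smul, hψ, smul_eq_mul, mul_one,
      Complex.ofReal_re]

/-- Discharge of `minEnergyOn_top`: on the whole space the sector energy
`inf {re ⟨ψ, A ψ⟩ : ‖ψ‖ = 1}` is the ground energy (lower bound `groundEnergy_le_rayleigh`,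
attained at a normalised ground-state vector, `groundSpace_ne_bot`). Tasaki (2020) §2.1, (2.1.6).
[folklore] -/
theorem minEnergyOn_top_holds : minEnergyOn_top (n := n) := by
  intro A hA _
  have hne : ∃ ψ : n → ℂ, ψ ∈ A.groundSpace ∧ star ψ ⬝ᵥ ψ = 1 := by
    obtain ⟨v, hv, hv0⟩ := (Submodule.ne_bot_iff _).1 (groundSpace_ne_bot_holds hA)
    have hpos : 0 < ‖(WithLp.toLp 2 v : EuclideanSpace ℂ n)‖ := by
      rw [norm_pos_iff]
      intro h
      exact hv0 (by simpa using congrArg WithLp.ofLp h)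
    refine ⟨((‖(WithLp.toLp 2 v : EuclideanSpace ℂ n)‖ : ℂ))⁻¹ • v, A.groundSpace.smul_mem _ hv, ?_⟩
    have h1 : ⟪(WithLp.toLp 2 v : EuclideanSpace ℂ n), WithLp.toLp 2 v⟫_ℂ = star v ⬝ᵥ v := by
      rw [EuclideanSpace.inner_eq_star_dotProduct, dotProduct_comm]
    have hvv : star v ⬝ᵥ v = ((‖(WithLp.toLp 2 v : EuclideanSpace ℂ n)‖ : ℂ)) ^ 2 := by
      rw [← h1, inner_self_eq_norm_sq_to_K]
      rfl
    rw [star_smul, smul_dotProduct, dotProduct_smul, hvv, smul_eq_mul, smul_eq_mul]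
    have hc0 : ((‖(WithLp.toLp 2 v : EuclideanSpace ℂ n)‖ : ℂ)) ≠ 0 := by
      exact_mod_cast hpos.ne'
    simp only [Complex.star_def, map_inv₀, Complex.conj_ofReal]
    field_simp
  apply le_antisymm
  · obtain ⟨ψ, hψ, hψ1⟩ := hne
    refine csInf_le ?_ ⟨ψ, Submodule.mem_top, hψ1, ?_⟩
    · refine ⟨A.groundEnergy, ?_⟩
      rintro E ⟨φ, -, hφ1, rfl⟩
      exact groundEnergy_le_rayleigh_holds hA φ hφ1
    · exact ((rayleigh_eq_groundEnergy_iff_holds hA ψ hψ1).2 hψ).symm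
  · obtain ⟨ψ, hψ, hψ1⟩ := hne
    refine le_csInf ⟨_, ψ, Submodule.mem_top, hψ1, rfl⟩ ?_
    rintro E ⟨φ, -, hφ1, rfl⟩
    exact groundEnergy_le_rayleigh_holds hA φ hφ1

/-! ### Unique gapped ground state = cluster gap with `m = 1`, `w = 0` -/

/-- Self-adjointness of `A` as a bounded operator on `EuclideanSpace ℂ n` is hermiticity of `A`
(transport along the star-algebra equivalence `Matrix.toEuclideanCLM`; cf.
`HasSpectralGap.isHermitian`). [folklore] -/
theorem isSelfAdjoint_toEuclideanCLM_iff (A : Matrix n n ℂ) :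
    IsSelfAdjoint (toEuclideanCLM (n := n) (𝕜 := ℂ) A) ↔ A.IsHermitian := by
  refine ⟨fun h => ?_, fun hA => hA.isSelfAdjoint.map _⟩
  have h2 : toEuclideanCLM (n := n) (𝕜 := ℂ) (star A) =
      star (toEuclideanCLM (n := n) (𝕜 := ℂ) A) :=
    (toEuclideanCLM (n := n) (𝕜 := ℂ)).map_star' A
  rw [h.star_eq] at h2
  exact (toEuclideanCLM (n := n) (𝕜 := ℂ)).injective h2

/-- The real parts of the spectrum of a Hermitian matrix `A`, viewed as a bounded operator on
`EuclideanSpace ℂ n`, form exactly the range of its eigenvalues (`spectrum_toEuclideanCLM` and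
Mathlib `Matrix.IsHermitian.spectrum_eq_image_range`). [folklore] -/
theorem IsHermitian.re_image_spectrum_toEuclideanCLM {A : Matrix n n ℂ} (hA : A.IsHermitian) :
    RCLike.re '' spectrum ℂ (toEuclideanCLM (n := n) (𝕜 := ℂ) A) = Set.range hA.eigenvalues := by
  rw [spectrum_toEuclideanCLM, hA.spectrum_eq_image_range, Set.image_image]
  ext x
  simp

/-- For a Hermitian matrix the indices `i` with `λᵢ ≤ ⨅ j, λⱼ` are exactly those with
`λᵢ = ⨅ j, λⱼ` (every eigenvalue is at least the infimum; the range is finite, hence bounded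
below). [folklore] -/
theorem IsHermitian.filter_eigenvalues_le_iInf {A : Matrix n n ℂ} (hA : A.IsHermitian) :
    (Finset.univ.filter fun i => hA.eigenvalues i ≤ ⨅ j, hA.eigenvalues j) =
      Finset.univ.filter fun i => hA.eigenvalues i = ⨅ j, hA.eigenvalues j := by
  ext i
  simp only [Finset.mem_filter, Finset.mem_univ, true_and]
  exact ⟨fun h => le_antisymm h (ciInf_le (Set.finite_range _).bddBelow i), le_of_eq⟩

/-- Discharge of the named fact `hasSpectralGap_iff_hasClusterGap_one`:
`A.HasSpectralGap Δ ↔ A.HasClusterGap 1 0 Δ`. Both predicates formalise the finite-volume notion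
"a unique ground state accompanied by a nonzero energy gap not less than `Δ > 0`" of Tasaki (2020),
§2.1 (the cite carried by the fact); the same notion is printed in H. Tasaki, *The
Lieb–Schultz–Mattis theorem: a topological point of view*, arXiv:2202.06243, §2.2 (p. 6) and
Definition 2.5 (p. 5, "the two definitions coincide in a finite system"). The proof is a transport
along `Matrix.toEuclideanCLM`: self-adjointness is hermiticity (`isSelfAdjoint_toEuclideanCLM_iff`);
the ground energy is `⨅ i, λᵢ` (`groundEnergy_eq_iInf_eigenvalues_holds`); the simple-eigenvalue
conjunct `finrank (eigenspace E₀) = 1` is the count `#{i | λᵢ ≤ E₀} = 1`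
(`HasSpectralGap.hasUniqueGroundState`, `HasClusterGap.groundStateDegeneracy_eq`,
`IsHermitian.card_filter_eigenvalues_eq`, `finrank_eigenspace_toEuclideanLin`); and
`re '' σ(A) = range λ` (`IsHermitian.re_image_spectrum_toEuclideanCLM`) turns
`re '' σ(A) ⊆ {E₀} ∪ [E₀ + Δ, ∞)` into `∀ i, λᵢ ≤ E₀ ∨ E₀ + Δ ≤ λᵢ`. No case split on `n` empty is
needed (both sides are then false: the count/finrank is `0 ≠ 1`). [cite: Tasaki2020] -/
theorem hasSpectralGap_iff_hasClusterGap_one_holds :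
    hasSpectralGap_iff_hasClusterGap_one (n := n) := by
  intro A Δ
  constructor
  · intro h
    have hA : A.IsHermitian := h.isHermitian
    have h1 : A.groundStateDegeneracy = 1 := h.hasUniqueGroundState
    have hE : (toEuclideanCLM (n := n) (𝕜 := ℂ) A).groundEnergy = ⨅ j, hA.eigenvalues j :=
      groundEnergy_eq_iInf_eigenvalues_holds hA
    obtain ⟨-, hΔ, -, hspec⟩ := h
    rw [groundStateDegeneracy, groundSpace, groundEnergy_eq_iInf_eigenvalues_holds hA,
      ← hA.card_filter_eigenvalues_eq, ← hA.filter_eigenvalues_le_iInf] at h1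
    refine ⟨hA, le_rfl, hΔ, by simpa only [add_zero] using h1, fun i => ?_⟩
    have hi : hA.eigenvalues i ∈ RCLike.re '' spectrum ℂ (toEuclideanCLM (n := n) (𝕜 := ℂ) A) := by
      rw [hA.re_image_spectrum_toEuclideanCLM]
      exact ⟨i, rfl⟩
    rcases hspec hi with h0 | h2
    · left
      rw [Set.mem_singleton_iff, hE] at h0
      rw [add_zero]
      exact h0.le
    · right
      rw [Set.mem_Ici, hE] at h2
      rwa [add_zero]
  · intro h
    have h1 : A.groundStateDegeneracy = 1 := h.groundStateDegeneracy_eq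
    obtain ⟨hA, -, hΔ, -, hgap⟩ := h
    have hE : (toEuclideanCLM (n := n) (𝕜 := ℂ) A).groundEnergy = ⨅ j, hA.eigenvalues j :=
      groundEnergy_eq_iInf_eigenvalues_holds hA
    refine ⟨(isSelfAdjoint_toEuclideanCLM_iff A).mpr hA, hΔ, ?_, fun x hx => ?_⟩
    · rw [groundStateDegeneracy, groundSpace, ← finrank_eigenspace_toEuclideanLin] at h1
      exact h1
    · rw [hA.re_image_spectrum_toEuclideanCLM] at hx
      obtain ⟨i, rfl⟩ := hx
      rcases hgap i with h0 | h2
      · left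
        rw [Set.mem_singleton_iff, hE]
        rw [add_zero] at h0
        exact le_antisymm h0 (ciInf_le (Set.finite_range _).bddBelow i)
      · right
        rw [Set.mem_Ici, hE]
        rwa [add_zero] at h2

end Matrix
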